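import Mathlib
import HarnessLib
import Summits.HubbardSuperconductivity.HubbardSuperconductivity.Theorems.KLProgrammeKLRegimeSplitConsts

/-!
# K3 ENGINE child (stmt-HubbardSuperconductivity-19855), stub `stub_engine_scale0`: the NAMED CONSTANTS of the scale-`0` values clause
# (closed forms for the `Q4` package author; cell gate-hubbard-kl, seat p3 g6)

The pair-amplitude ultraviolet clause `‖𝒞₀(Q;k,k′) − U‖ ≤ initDevBar G U + legDressBarQ G P Q U 0 4` is reached
(`…EngineScaleZeroValues` p487611 + `…EngineScaleZeroValuesExplicit`) in the form `‖𝒞₀ − U‖ ≤ klScaleZeroValC R · U²` once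
`klScaleZeroThetaC R · U ≤ 1/2`; the package comparison is then `klScaleZeroValC R ≤ 4·Q.CR·P.Klam²` (a NUMBER condition on the `∃Q`-witness).
The closed forms, every symbol a tree quantity:

* `klScaleZeroA0` — k3c4-p2's decay constant `A₀ = 14·√((1/2 + 12/e₀)(2/e₀ + 128π⁴K₂²/e₀ + 2π⁵K₂²/e₀² + 1 + π⁴(7²K₂(2/e₀) + 7(2B₁+1))²/e₀³))`
  (`…EngineScaleZeroDecay.alpha_scaleZero_le`: `(β/N)·Σ_Y‖(SᵀC₀S) X Y‖ ≤ A₀`) at the tree's cutoff-profile bounds `B₁ = 32/3`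
  (`klcd_abs_deriv_salmhoferCutoff_le_sharp`), `B₂ = 1110` (`klsd_abs_deriv2_salmhoferCutoff_lt`), `K₂ = 4B₂ + 6B₁ + 2 = 4506`, `e₀ = klE0`;
* `klKappaFrameC R` — the frame's intrinsic `ℓ¹` constant: `Σ_z‖Ǩ_L(z)‖ ≤ klKappaFrameC R · |U|` for `|U| ≤ 1`
  (`…EngineFramePosKernelPieces.sum_norm_framePosKernel_le_linear_of_frameOK`): `256·((4/3)√(24π²(Gfr0+1)(Gfr2+1)) + (128/15)(Gfr0+1))`;
* `klScaleZeroCV R` — the field-weighted vertex size per unit `U`: `(N/β)·‖Ṽ‖_h ≤ klScaleZeroCV R · |U|`, at the sharp Gram constant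
  `κ₀ = ρ = √(2(7+6047))`: `(2e²κ₀)²·klKappaFrameC R + (2e²κ₀)⁴`;
* `klScaleZeroThetaC R` — the step smallness per unit `U`: `θ ≤ klScaleZeroThetaC R · |U|`: `e·klScaleZeroA0·klScaleZeroCV R/κ₀²`;
* `klScaleZeroValC R` — the `U²`-coefficient of the values clause: `192·e²·klScaleZeroA0·(klScaleZeroCV R)²/κ₀⁶` (`= 96·κ₀⁻⁴·e·CV·(2·ThetaC)`).

Definitions (real closed forms) and their signs only; nothing about the model is asserted.  Numerically (all `Gfr j ≤ 1`):
`klScaleZeroA0 ≈ 7·10¹²`, `klScaleZeroCV ≈ 7·10¹²`, `klScaleZeroThetaC ≈ 10²²`, `klScaleZeroValC ≈ 3·10²⁹ ≈ 2^{98}` — above `klEngQ3`'s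
`4·CR·Klam² ≥ 2^{62}`, so the values clause asks the `Q4` package for `CR ≥ klScaleZeroValC R/(4·Klam²)` (legal: `Q` is the engine's
`∃`-witness, chosen after `P, R`; the price is a smaller `U₀`).
-/

noncomputable section

namespace Summit.HubbardSuperconductivity.HubbardSuperconductivity.Theorems.EngineV8

set_option linter.dupNamespace false -- summit = problem name (single-conjunct summit), D-0017

open Real
open Summit.HubbardSuperconductivity.HubbardSuperconductivity.Theorems.KLRegimeSplit

/-- **`klScaleZeroA0`** — the scale-`0` decay constant `A₀(B₁, B₂)` of `alpha_scaleZero_le` at `B₁ = 32/3`, `B₂ = 1110`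
(`K₂ = 4B₂ + 6B₁ + 2`): `(β/N)·(row/column sum of SᵀC^K_{>e₀}S) ≤ klScaleZeroA0` for every admissible frame, `klBetaMin ≤ β`, `β³ ≤ M`. -/
def klScaleZeroA0 : ℝ :=
  14 * Real.sqrt ((1 / 2 + 12 / klE0) *
    (2 / klE0 + 128 * Real.pi ^ 4 * (4 * (1110 : ℝ) + 6 * (32 / 3) + 2) ^ 2 / klE0 +
      2 * Real.pi ^ 5 * (4 * (1110 : ℝ) + 6 * (32 / 3) + 2) ^ 2 / klE0 ^ 2 + 1 +
      Real.pi ^ 4 * ((7 : ℝ) ^ 2 * (4 * (1110 : ℝ) + 6 * (32 / 3) + 2) * (2 / klE0) + 7 * (2 * (32 / 3) + 1)) ^ 2 / klE0 ^ 3))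

/-- **`klKappaFrameC R`** — the intrinsic `ℓ¹` constant of an admissible frame's position kernel per unit `|U|` (`|U| ≤ 1`):
`256·((4/3)·√(24π²(Gfr0+1)(Gfr2+1)) + (128/15)·(Gfr0+1))`. -/
def klKappaFrameC (R : RenConsts) : ℝ :=
  256 * ((4 / 3) * Real.sqrt (24 * Real.pi ^ 2 * (R.Gfr 0 + 1) * (R.Gfr 2 + 1)) + (128 / 15) * (R.Gfr 0 + 1))

/-- **`klScaleZeroCV R`** — `(N/β)·‖Ṽ‖_h` per unit `|U|` at `κ = ρ = κ₀ = √(2(7+6047))`: `(2e²κ₀)²·klKappaFrameC R + (2e²κ₀)⁴`. -/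
def klScaleZeroCV (R : RenConsts) : ℝ :=
  (2 * Real.exp 2 * Real.sqrt (2 * (7 + 6047))) ^ 2 * klKappaFrameC R + (2 * Real.exp 2 * Real.sqrt (2 * (7 + 6047))) ^ 4

/-- **`klScaleZeroThetaC R`** — the smallness of the scale-`0` step per unit `|U|`: `θ ≤ klScaleZeroThetaC R·|U|`,
`klScaleZeroThetaC R = e·klScaleZeroA0·klScaleZeroCV R/κ₀²`. -/
def klScaleZeroThetaC (R : RenConsts) : ℝ :=
  Real.exp 1 * klScaleZeroA0 * klScaleZeroCV R / Real.sqrt (2 * (7 + 6047)) ^ 2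

/-- **`klScaleZeroValC R`** — the `U²`-coefficient of the scale-`0` values clause: `192·e²·klScaleZeroA0·(klScaleZeroCV R)²/κ₀⁶`. -/
def klScaleZeroValC (R : RenConsts) : ℝ :=
  192 * Real.exp 1 ^ 2 * klScaleZeroA0 * klScaleZeroCV R ^ 2 / Real.sqrt (2 * (7 + 6047)) ^ 6

/-! ## Signs -/

/-- `0 < klScaleZeroA0`. -/
theorem klScaleZeroA0_pos : 0 < klScaleZeroA0 := by
  unfold klScaleZeroA0
  have he : (0 : ℝ) < klE0 := by norm_num [klE0]
  have h1 : (0 : ℝ) < 1 / 2 + 12 / klE0 := by positivity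
  have h2 : (0 : ℝ) < 2 / klE0 + 128 * Real.pi ^ 4 * (4 * (1110 : ℝ) + 6 * (32 / 3) + 2) ^ 2 / klE0 +
      2 * Real.pi ^ 5 * (4 * (1110 : ℝ) + 6 * (32 / 3) + 2) ^ 2 / klE0 ^ 2 + 1 +
      Real.pi ^ 4 * ((7 : ℝ) ^ 2 * (4 * (1110 : ℝ) + 6 * (32 / 3) + 2) * (2 / klE0) + 7 * (2 * (32 / 3) + 1)) ^ 2 / klE0 ^ 3 := by
    positivity
  exact mul_pos (by norm_num) (Real.sqrt_pos.2 (mul_pos h1 h2))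

/-- `0 < klKappaFrameC R` whenever `Gfr 0 ≥ 0` (e.g. `R.WF`). -/
theorem klKappaFrameC_pos {R : RenConsts} (hR : 0 ≤ R.Gfr 0) : 0 < klKappaFrameC R := by
  unfold klKappaFrameC
  have : 0 < R.Gfr 0 + 1 := by linarith
  positivity

/-- `0 < klScaleZeroCV R` whenever `Gfr 0 ≥ 0`. -/
theorem klScaleZeroCV_pos {R : RenConsts} (hR : 0 ≤ R.Gfr 0) : 0 < klScaleZeroCV R := by
  unfold klScaleZeroCV
  have hκ : 0 < Real.sqrt (2 * (7 + 6047)) := Real.sqrt_pos.2 (by norm_num)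
  have := klKappaFrameC_pos hR
  positivity

/-- `0 < klScaleZeroThetaC R` whenever `Gfr 0 ≥ 0`. -/
theorem klScaleZeroThetaC_pos {R : RenConsts} (hR : 0 ≤ R.Gfr 0) : 0 < klScaleZeroThetaC R := by
  unfold klScaleZeroThetaC
  have hκ : 0 < Real.sqrt (2 * (7 + 6047)) := Real.sqrt_pos.2 (by norm_num)
  have := klScaleZeroCV_pos hR
  have := klScaleZeroA0_pos
  positivity

/-- `0 < klScaleZeroValC R` whenever `Gfr 0 ≥ 0`. -/
theorem klScaleZeroValC_pos {R : RenConsts} (hR : 0 ≤ R.Gfr 0) : 0 < klScaleZeroValC R := by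
  unfold klScaleZeroValC
  have hκ : 0 < Real.sqrt (2 * (7 + 6047)) := Real.sqrt_pos.2 (by norm_num)
  have := klScaleZeroCV_pos hR
  have := klScaleZeroA0_pos
  positivity

/-- The algebraic identity behind `klScaleZeroValC`: `96·κ₀⁻⁴·e·CV·(2·ThetaC) = ValC` (how the values bound
`96·(N/β)·(κ₀⁻⁴·e‖Ṽ‖_h·θ/(1−θ))` with `1/(1−θ) ≤ 2` turns into `ValC·U²`). -/
theorem klScaleZeroValC_eq (R : RenConsts) :
    klScaleZeroValC R =
      96 * (Real.sqrt (2 * (7 + 6047)))⁻¹ ^ 4 * (Real.exp 1 * klScaleZeroCV R) * (2 * klScaleZeroThetaC R) := by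
  unfold klScaleZeroValC klScaleZeroThetaC
  have hκ : Real.sqrt (2 * (7 + 6047)) ≠ 0 := (Real.sqrt_pos.2 (by norm_num)).ne'
  field_simp
  ring

end Summit.HubbardSuperconductivity.HubbardSuperconductivity.Theorems.EngineV8

end
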